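import Mathlib
import Literature.Geometry.DiscreteGeometry.BondGraph

/-!
# The abstract charge-freeness engine in ratio form

Stub `stub_ratioGermEngine` (T2) of the line `elastic-basin-split` for the crux
`PricedLinkCensus.TruncatedCensusGap` (item stmt-AtomisticToContinuum-14230), registered by
`ledger skeleton check` on `Cruxes/TruncatedCensusGap/Lines/elastic_basin_split.lean`.
The final statement is the registered signature VERBATIM (self-contained over tree declarations).

This is the RATIO-FORM twin of the landed abstract engines `isChargeFree_of_germMatched`
(`…ChargeFreeOpenAtGerm`) and `isChargeFree_of_wideGermMatched` (`…ChargeFreeOpenAtBarlow`):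
there the reference point set `T` has ONE global window for its near distances; here there is
no global window, only

* a separation `0.8793`, an upper bound `1.0747` for the near (`< 1.231`) distances, twelve near
  points around every centre and four common near points around every near pair, and
* a PER-CENTRE RATIO bound: around every centre within `2.4425` of the root site `y i`, any two
  near lengths differ by a factor at most `2007/2000 = 1.0035`;

while the configuration `y` is `0.4885`-separated within `2.931` of `y i`, every point of `T`
within `2.931` of `y i` has a site within `977/8000` (coarse matching) and every site within
`2.4425` of `y i` has a point of `T` within `δ := 977/5000000 ≈ 1.954 · 10⁻⁴` (fine matching).

## Proof layout and margin ledger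

* `rgerm_point_unique`, `rgerm_site_unique`: points of `T` (sites near the root) within total
  distance `< 0.8793` (`< 0.4885`) of a common point coincide.
* `rgerm_fine`: the coarse matching is automatically fine within `2.32` of the root site: the
  coarse site of `z` is within `2.32 + 0.122125 ≤ 2.4425` of `y i`, hence `δ`-close to a point
  of `T`, which is within `δ + 0.122125 < 0.8793` of `z`, hence is `z`.
* `rgerm_near_site`: a near point `z` of the root point `z₀` (`dist (y i) z₀ < δ`) has
  `dist z z₀ ≤ 1.0747`, lies within `1.0747 + δ` of `y i`, its site `J z` is `δ`-close to it,
  `dist (y i) (y (J z)) < dist z z₀ + 2δ`, and `J z ≠ i` (else `dist z z₀ < 2δ < 0.8793`).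
* `rgerm_le_dist` / `rgerm_le_nearestDist` (NO minima): if the site `j` is `δ`-close to a point
  `z ∈ T` within `1.08` of `y i`, and `L ≤ 1.0747` is a lower bound for ALL near lengths at the
  centre `z`, then every other site is `≥ L − 2δ` away from `y j`: a competitor `k` within
  `2.4425` of `y i` is `δ`-matched to `Z k ≠ z` (else `dist < 2δ < 0.4885`); if `Z k` is near `z`
  then `dist ≥ dist (Z k) z − 2δ ≥ L − 2δ`, if not then `dist ≥ 1.231 − 2δ ≥ L − 2δ`; a competitor
  farther than `2.4425` from `y i` is `≥ 2.4425 − 1.08 − δ > 1.0747 ≥ L` away.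
* Root bonds `i ∼ J z` (`z` near `z₀`, `d := dist z z₀ ≥ 0.8793`): take `L := (2000/2007) d` both
  for `nn_i` (ratio bound at the centre `z₀`) and for `nn_{J z}` (ratio bound at the centre `z`,
  pair `(z₀, ·)`).  KEY INEQUALITY: `d + 2δ ≤ (101/100)((2000/2007) d − 2δ)`, i.e.
  `4.02 δ = 7.86 · 10⁻⁴ ≤ (2020/2007 − 1) d = 6.477 · 10⁻³ d`, true for `d ≥ 0.8793`
  (`5.69 · 10⁻³`).
* Root non-bonds: `nn_i ≤ 1.076`, so a bond at `i` is `≤ 1.01 · 1.076 = 1.08676` long, its end is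
  `δ`-matched to a point of `T` within `1.08676 + 2δ < 1.231` of `z₀`, a near point, whose site it
  is (`rgerm_site_unique`); whence `rgerm_neighborSet_root` and, with twelve near points and the
  injectivity `rgerm_injOn` of the matching, twelve bonds.
* Ring numbers (`rgerm_inter_neighborSet`): for a near point `z` of `z₀`, the common bond
  neighbours of `i` and `J z` are the sites of the common near points `w` of `z₀` and `z`:
  `⊇` by the shell bond `J z ∼ J w` with `L := (2000/2007) dist w z` for both `nn_{J z}` (ratio at
  the centre `z`) and `nn_{J w}` (ratio at the centre `w`), same KEY INEQUALITY; `⊆` since a bond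
  at `J z` is `≤ 1.01 · nn_{J z} ≤ 1.01 · 1.076` long, so its matched points are `< 1.08676 + 2δ
  < 1.231` apart.  Four common near points and injectivity give ring number `4`.
* All radii fit: first-shell points `≤ 1.0747 + δ < 1.08` and sites `< 1.076` from `y i`;
  competitors `≤ 2.4425`; the ratio bound is used only at the centres `z₀` and first-shell points.
-/

noncomputable section

namespace Summit.AtomisticToContinuum.Crystallization.Theorems.PricedLinkCensusTruncatedCensusGap

open Literature.Geometry.DiscreteGeometry

section RatioGermMatched

variable {ι X : Type*} [PseudoMetricSpace X] {y : ι → X} {i : ι} {T : Set X}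
  {z₀ : X} {Z : ι → X} {J : X → ι}

-- adapted from `germ_point_unique` in `PricedLinkCensusTruncatedCensusGapChargeFreeOpenAtGerm`
/-- Two points of a `0.8793`-separated set at total distance `< 0.8793` from a common point
coincide. [folklore] -/
theorem rgerm_point_unique
    (hT1 : ∀ z ∈ T, ∀ w ∈ T, z ≠ w → (8793 / 10000 : ℝ) ≤ dist z w)
    {p z w : X} (hz : z ∈ T) (hw : w ∈ T) (hp : dist p z + dist p w < 8793 / 10000) :
    z = w := by
  by_contra hne
  have h1 := hT1 z hz w hw hne
  have h2 := dist_triangle_left z w p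
  linarith

-- adapted from `germ_site_unique` in `PricedLinkCensusTruncatedCensusGapChargeFreeOpenAtGerm`
/-- Two sites at total distance `< 0.4885` from a common point, the first within `2.931` of the
root site, coincide (by the `0.4885`-separation near the root). [folklore] -/
theorem rgerm_site_unique
    (hsep : ∀ j k, j ≠ k → dist (y j) (y i) ≤ 2931 / 1000 → (977 / 2000 : ℝ) ≤ dist (y j) (y k))
    {j k : ι} {p : X} (hj : dist (y j) (y i) ≤ 2931 / 1000)
    (hp : dist (y j) p + dist (y k) p < 977 / 2000) : j = k := by
  by_contra hne
  have h1 := hsep j k hne hj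
  have h2 := dist_triangle_right (y j) (y k) p
  linarith

/-- **The coarse matching is fine near the root**: a point `z ∈ T` within `2.32` of the root
site is within `δ = 977/5000000` of its coarse site `J z` (the coarse site is within `2.4425` of
the root site, hence `δ`-close to a point of `T`, which can only be `z`). [folklore] -/
theorem rgerm_fine
    (hT1 : ∀ z ∈ T, ∀ w ∈ T, z ≠ w → (8793 / 10000 : ℝ) ≤ dist z w)
    (hZ : ∀ j, dist (y j) (y i) ≤ 4885 / 2000 → Z j ∈ T ∧ dist (y j) (Z j) < 977 / 5000000)
    (hJ : ∀ z ∈ T, dist z (y i) ≤ 2931 / 1000 → dist (y (J z)) z ≤ 977 / 8000)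
    {z : X} (hz : z ∈ T) (hzi : dist z (y i) ≤ 232 / 100) :
    dist (y (J z)) z < 977 / 5000000 := by
  have hJz := hJ z hz (by linarith)
  have hJzi : dist (y (J z)) (y i) ≤ 4885 / 2000 := by
    have := dist_triangle (y (J z)) z (y i)
    linarith
  obtain ⟨hZJ, hdZJ⟩ := hZ (J z) hJzi
  have heq : Z (J z) = z := rgerm_point_unique hT1 (p := y (J z)) hZJ hz (by linarith)
  rw [heq] at hdZJ
  exact hdZJ

-- adapted from `wgerm_near_site` in `PricedLinkCensusTruncatedCensusGapChargeFreeOpenAtBarlow`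
/-- A near point `z` of the root point `z₀` is at distance `≤ 1.0747` from `z₀` and
`< 1.0747 + δ` from the root site, is `δ`-matched by its site `J z`, which is at distance
`< dist z z₀ + 2δ` from the root site and is not the root site. [folklore] -/
theorem rgerm_near_site
    (hT1 : ∀ z ∈ T, ∀ w ∈ T, z ≠ w → (8793 / 10000 : ℝ) ≤ dist z w)
    (hT2 : ∀ z₀ ∈ T, ∀ z ∈ T, z ≠ z₀ → dist z z₀ < 1231 / 1000 → dist z z₀ ≤ 10747 / 10000)
    (hZ : ∀ j, dist (y j) (y i) ≤ 4885 / 2000 → Z j ∈ T ∧ dist (y j) (Z j) < 977 / 5000000)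
    (hJ : ∀ z ∈ T, dist z (y i) ≤ 2931 / 1000 → dist (y (J z)) z ≤ 977 / 8000)
    (hz₀ : z₀ ∈ T) (hiz₀ : dist (y i) z₀ < 977 / 5000000)
    {z : X} (hz : z ∈ T) (hne : z ≠ z₀) (hd : dist z z₀ < 1231 / 1000) :
    dist (y (J z)) z < 977 / 5000000 ∧ dist z z₀ ≤ 10747 / 10000 ∧
      dist z (y i) < 10747 / 10000 + 977 / 5000000 ∧
      dist (y i) (y (J z)) < dist z z₀ + 2 * (977 / 5000000) ∧ i ≠ J z := by
  have hhi := hT2 z₀ hz₀ z hz hne hd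
  have hzi : dist z (y i) < 10747 / 10000 + 977 / 5000000 := by
    have := dist_triangle z z₀ (y i)
    rw [dist_comm z₀ (y i)] at this
    linarith
  have hJz := rgerm_fine hT1 hZ hJ hz (by linarith)
  refine ⟨hJz, hhi, hzi, ?_, ?_⟩
  · have h4 := dist_triangle4 (y i) z₀ z (y (J z))
    rw [dist_comm z₀ z, dist_comm z (y (J z))] at h4
    linarith
  · intro heq
    rw [← heq] at hJz
    have := dist_triangle z (y i) z₀
    rw [dist_comm z (y i)] at this
    have h1 := hT1 z hz z₀ hz₀ hne
    linarith

/-- **Lower bound for the other distances, ratio form (no minima).** If the site `j` is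
`δ`-close to a point `z ∈ T` within `1.08` of the root site, and `L ≤ 1.0747` is a lower bound
for all the near lengths at the centre `z`, then every other site is at distance `≥ L − 2δ` from
`y j`. [folklore] -/
theorem rgerm_le_dist
    (hsep : ∀ j k, j ≠ k → dist (y j) (y i) ≤ 2931 / 1000 → (977 / 2000 : ℝ) ≤ dist (y j) (y k))
    (hZ : ∀ j, dist (y j) (y i) ≤ 4885 / 2000 → Z j ∈ T ∧ dist (y j) (Z j) < 977 / 5000000)
    {j : ι} {z : X} {L : ℝ} (hjz : dist (y j) z < 977 / 5000000)
    (hzi : dist z (y i) ≤ 1080 / 1000)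
    (hL : ∀ w ∈ T, w ≠ z → dist w z < 1231 / 1000 → L ≤ dist w z) (hL' : L ≤ 10747 / 10000)
    {k : ι} (hkj : k ≠ j) :
    L - 2 * (977 / 5000000) ≤ dist (y j) (y k) := by
  have hji : dist (y j) (y i) ≤ 1080 / 1000 + 977 / 5000000 := by
    have := dist_triangle (y j) z (y i)
    linarith
  by_cases hk : dist (y k) (y i) ≤ 4885 / 2000
  · obtain ⟨hZk, hdk⟩ := hZ k hk
    have hne : Z k ≠ z := by
      intro heq
      have h1 := hsep j k hkj.symm (by linarith)
      have h2 := dist_triangle_right (y j) (y k) z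
      rw [heq] at hdk
      linarith
    have h4 := dist_triangle4 (Z k) (y k) (y j) z
    rw [dist_comm (Z k) (y k), dist_comm (y k) (y j)] at h4
    by_cases hnear : dist (Z k) z < 1231 / 1000
    · have hLk := hL (Z k) hZk hne hnear
      linarith
    · push Not at hnear
      linarith
  · push Not at hk
    have := dist_triangle (y k) (y j) (y i)
    rw [dist_comm (y k) (y j)] at this
    linarith

/-- Hence, under the same hypotheses, `L − 2δ ≤ nn_j`. [folklore] -/
theorem rgerm_le_nearestDist
    (hsep : ∀ j k, j ≠ k → dist (y j) (y i) ≤ 2931 / 1000 → (977 / 2000 : ℝ) ≤ dist (y j) (y k))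
    (hZ : ∀ j, dist (y j) (y i) ≤ 4885 / 2000 → Z j ∈ T ∧ dist (y j) (Z j) < 977 / 5000000)
    (hnt : ∀ j : ι, ∃ k, k ≠ j)
    {j : ι} {z : X} {L : ℝ} (hjz : dist (y j) z < 977 / 5000000)
    (hzi : dist z (y i) ≤ 1080 / 1000)
    (hL : ∀ w ∈ T, w ≠ z → dist w z < 1231 / 1000 → L ≤ dist w z) (hL' : L ≤ 10747 / 10000) :
    L - 2 * (977 / 5000000) ≤ nearestDist y j :=
  le_nearestDist (hnt j) fun _ hk => rgerm_le_dist hsep hZ hjz hzi hL hL' hk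

-- adapted from `wgerm_neighborSet_root` in
-- `PricedLinkCensusTruncatedCensusGapChargeFreeOpenAtBarlow`
/-- **The bonds of the root site** are exactly the sites of the near points of the root point
(ratio form: bond test `d + 2δ ≤ (101/100)((2000/2007) d − 2δ)` for `d ≥ 0.8793`; non-bond test
`1.01 · 1.076 + 2δ < 1.231`). [folklore] -/
theorem rgerm_neighborSet_root
    (hT1 : ∀ z ∈ T, ∀ w ∈ T, z ≠ w → (8793 / 10000 : ℝ) ≤ dist z w)
    (hT2 : ∀ z₀ ∈ T, ∀ z ∈ T, z ≠ z₀ → dist z z₀ < 1231 / 1000 → dist z z₀ ≤ 10747 / 10000)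
    (hR : ∀ z₀ ∈ T, dist z₀ (y i) ≤ 4885 / 2000 → ∀ z ∈ T, ∀ z' ∈ T, z ≠ z₀ → z' ≠ z₀ →
      dist z z₀ < 1231 / 1000 → dist z' z₀ < 1231 / 1000 → dist z z₀ ≤ 2007 / 2000 * dist z' z₀)
    (hsep : ∀ j k, j ≠ k → dist (y j) (y i) ≤ 2931 / 1000 → (977 / 2000 : ℝ) ≤ dist (y j) (y k))
    (hZ : ∀ j, dist (y j) (y i) ≤ 4885 / 2000 → Z j ∈ T ∧ dist (y j) (Z j) < 977 / 5000000)
    (hJ : ∀ z ∈ T, dist z (y i) ≤ 2931 / 1000 → dist (y (J z)) z ≤ 977 / 8000)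
    (hz₀ : z₀ ∈ T) (hiz₀ : dist (y i) z₀ < 977 / 5000000) (hnt : ∀ j : ι, ∃ k, k ≠ j)
    (hnni : nearestDist y i ≤ 1076 / 1000) :
    (bondGraph (1 / 100 : ℝ) y).neighborSet i =
      J '' {z ∈ T | z ≠ z₀ ∧ dist z z₀ < 1231 / 1000} := by
  ext k
  rw [mem_neighborSet_bondGraph]
  constructor
  · rintro ⟨hik, hdk⟩
    have hmin := min_le_left (nearestDist y i) (nearestDist y k)
    have hd : dist (y i) (y k) ≤ 108676 / 100000 := by linarith
    have hk3 : dist (y k) (y i) ≤ 4885 / 2000 := by rw [dist_comm]; linarith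
    obtain ⟨hZk, hdZk⟩ := hZ k hk3
    have hne : Z k ≠ z₀ := by
      intro heq
      have h1 := hsep k i (Ne.symm hik) (by linarith)
      have h2 := dist_triangle_right (y k) (y i) (Z k)
      rw [heq] at h2 hdZk
      linarith
    have hkz₀ := dist_triangle4 (Z k) (y k) (y i) z₀
    rw [dist_comm (Z k) (y k), dist_comm (y k) (y i)] at hkz₀
    have hnear : dist (Z k) z₀ < 1231 / 1000 := by linarith
    refine ⟨Z k, ⟨hZk, hne, hnear⟩, ?_⟩
    obtain ⟨hJZk, -⟩ := rgerm_near_site hT1 hT2 hZ hJ hz₀ hiz₀ hZk hne hnear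
    exact (rgerm_site_unique hsep (p := Z k) (by linarith) (by linarith)).symm
  · rintro ⟨z, ⟨hz, hne, hd⟩, rfl⟩
    obtain ⟨hJz, hhi, hzi, hdist, hiJ⟩ := rgerm_near_site hT1 hT2 hZ hJ hz₀ hiz₀ hz hne hd
    refine ⟨hiJ, ?_⟩
    have hlo := hT1 z hz z₀ hz₀ hne
    have hz₀i : dist z₀ (y i) ≤ 1080 / 1000 := by rw [dist_comm]; linarith
    have hLi : ∀ w ∈ T, w ≠ z₀ → dist w z₀ < 1231 / 1000 →
        2000 / 2007 * dist z z₀ ≤ dist w z₀ := by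
      intro w hw hwne hwd
      have := hR z₀ hz₀ (by linarith) z hz w hw hne hwne hd hwd
      linarith
    have hLz : ∀ w ∈ T, w ≠ z → dist w z < 1231 / 1000 → 2000 / 2007 * dist z z₀ ≤ dist w z := by
      intro w hw hwne hwd
      have := hR z hz (by linarith) z₀ hz₀ w hw hne.symm hwne (by rwa [dist_comm]) hwd
      rw [dist_comm z₀ z] at this
      linarith
    have hL' : 2000 / 2007 * dist z z₀ ≤ 10747 / 10000 := by linarith
    have h1 := rgerm_le_nearestDist hsep hZ hnt hiz₀ hz₀i hLi hL'
    have h2 := rgerm_le_nearestDist hsep hZ hnt hJz (by linarith) hLz hL'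
    have h := le_min h1 h2
    linarith

-- adapted from `wgerm_inter_neighborSet` in
-- `PricedLinkCensusTruncatedCensusGapChargeFreeOpenAtBarlow`
/-- **The common bond-neighbours of a root bond** `{i, J z}` among the bonds of the root are
exactly the sites of the common near points of `z₀` and `z` (ratio form: shell bond test
`d + 2δ ≤ (101/100)((2000/2007) d − 2δ)` with `d = dist w z ≥ 0.8793`, the ratio bound being
used at the centres `z` and `w`). [folklore] -/
theorem rgerm_inter_neighborSet
    (hT1 : ∀ z ∈ T, ∀ w ∈ T, z ≠ w → (8793 / 10000 : ℝ) ≤ dist z w)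
    (hT2 : ∀ z₀ ∈ T, ∀ z ∈ T, z ≠ z₀ → dist z z₀ < 1231 / 1000 → dist z z₀ ≤ 10747 / 10000)
    (hR : ∀ z₀ ∈ T, dist z₀ (y i) ≤ 4885 / 2000 → ∀ z ∈ T, ∀ z' ∈ T, z ≠ z₀ → z' ≠ z₀ →
      dist z z₀ < 1231 / 1000 → dist z' z₀ < 1231 / 1000 → dist z z₀ ≤ 2007 / 2000 * dist z' z₀)
    (hsep : ∀ j k, j ≠ k → dist (y j) (y i) ≤ 2931 / 1000 → (977 / 2000 : ℝ) ≤ dist (y j) (y k))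
    (hZ : ∀ j, dist (y j) (y i) ≤ 4885 / 2000 → Z j ∈ T ∧ dist (y j) (Z j) < 977 / 5000000)
    (hJ : ∀ z ∈ T, dist z (y i) ≤ 2931 / 1000 → dist (y (J z)) z ≤ 977 / 8000)
    (hz₀ : z₀ ∈ T) (hiz₀ : dist (y i) z₀ < 977 / 5000000) (hnt : ∀ j : ι, ∃ k, k ≠ j)
    {z : X} (hz : z ∈ T) (hne : z ≠ z₀) (hd : dist z z₀ < 1231 / 1000) :
    J '' {w ∈ T | w ≠ z₀ ∧ dist w z₀ < 1231 / 1000} ∩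
        (bondGraph (1 / 100 : ℝ) y).neighborSet (J z) =
      J '' {w ∈ T | w ≠ z₀ ∧ w ≠ z ∧ dist w z₀ < 1231 / 1000 ∧ dist w z < 1231 / 1000} := by
  obtain ⟨hJz, hhi, hzi, hdist, hiJz⟩ := rgerm_near_site hT1 hT2 hZ hJ hz₀ hiz₀ hz hne hd
  have hnn : nearestDist y (J z) ≤ 1076 / 1000 :=
    (nearestDist_le_dist y hiJz).trans (by rw [dist_comm]; linarith)
  ext k
  simp only [Set.mem_inter_iff, Set.mem_image, Set.mem_setOf_eq, mem_neighborSet_bondGraph]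
  constructor
  · rintro ⟨⟨w, ⟨hw, hwne, hwd⟩, rfl⟩, hJzw, hdzw⟩
    obtain ⟨hJw, -⟩ := rgerm_near_site hT1 hT2 hZ hJ hz₀ hiz₀ hw hwne hwd
    have hmin := min_le_left (nearestDist y (J z)) (nearestDist y (J w))
    have hdist' : dist (y (J z)) (y (J w)) ≤ 108676 / 100000 := by linarith
    have h4 := dist_triangle4 w (y (J w)) (y (J z)) z
    rw [dist_comm w (y (J w)), dist_comm (y (J w)) (y (J z))] at h4
    exact ⟨w, ⟨hw, hwne, fun h => hJzw (by rw [h]), hwd, by linarith⟩, rfl⟩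
  · rintro ⟨w, ⟨hw, hwne, hwz, hwd, hwzd⟩, rfl⟩
    obtain ⟨hJw, -, hwi, -, -⟩ := rgerm_near_site hT1 hT2 hZ hJ hz₀ hiz₀ hw hwne hwd
    refine ⟨⟨w, ⟨hw, hwne, hwd⟩, rfl⟩, ?_, ?_⟩
    · intro heq
      rw [heq] at hJz
      exact hwz (rgerm_point_unique hT1 (p := y (J w)) hw hz (by linarith))
    · have hlo := hT1 w hw z hz hwz
      have hwzhi := hT2 z hz w hw hwz hwzd
      have hLz : ∀ w' ∈ T, w' ≠ z → dist w' z < 1231 / 1000 →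
          2000 / 2007 * dist w z ≤ dist w' z := by
        intro w' hw' hw'ne hw'd
        have := hR z hz (by linarith) w hw w' hw' hwz hw'ne hwzd hw'd
        linarith
      have hLw : ∀ w' ∈ T, w' ≠ w → dist w' w < 1231 / 1000 →
          2000 / 2007 * dist w z ≤ dist w' w := by
        intro w' hw' hw'ne hw'd
        have := hR w hw (by linarith) z hz w' hw' (Ne.symm hwz) hw'ne (by rwa [dist_comm]) hw'd
        rw [dist_comm z w] at this
        linarith
      have hL' : 2000 / 2007 * dist w z ≤ 10747 / 10000 := by linarith
      have h1 := rgerm_le_nearestDist hsep hZ hnt hJz (by linarith) hLz hL'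
      have h2 := rgerm_le_nearestDist hsep hZ hnt hJw (by linarith) hLw hL'
      have h := le_min h1 h2
      have h4 := dist_triangle4 (y (J z)) z w (y (J w))
      rw [dist_comm z w, dist_comm w (y (J w))] at h4
      linarith

-- adapted from `germ_injOn` in `PricedLinkCensusTruncatedCensusGapChargeFreeOpenAtGerm`
/-- The coarse matching `z ↦ J z` is injective on the points of `T` within `2.931` of the root
site (`2 · 977/8000 < 0.8793`). [folklore] -/
theorem rgerm_injOn
    (hT1 : ∀ z ∈ T, ∀ w ∈ T, z ≠ w → (8793 / 10000 : ℝ) ≤ dist z w)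
    (hJ : ∀ z ∈ T, dist z (y i) ≤ 2931 / 1000 → dist (y (J z)) z ≤ 977 / 8000) :
    Set.InjOn J {z ∈ T | dist z (y i) ≤ 2931 / 1000} := by
  rintro z ⟨hz, hz3⟩ w ⟨hw, hw3⟩ heq
  have h1 := hJ z hz hz3
  have h2 := hJ w hw hw3
  rw [heq] at h1
  exact rgerm_point_unique hT1 (p := y (J w)) hz hw (by linarith)

-- adapted from `isChargeFree_of_wideGermMatched` in
-- `PricedLinkCensusTruncatedCensusGapChargeFreeOpenAtBarlow`
/-- **Charge-freeness of a ratio-germ-matched site (abstract form).** Let `T` be a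
`0.8793`-separated point set whose near points (`< 1.231`) of every centre are twelve, at
distance `≤ 1.0747`, any two near points having exactly four common near points, and whose near
lengths around every centre within `2.4425` of the site `y i` have pairwise ratios `≤ 2007/2000`.
If the sites within `2.931` of `y i` are `0.4885`-separated, every point of `T` within `2.931` of
`y i` has a site within `977/8000`, and every site within `2.4425` of `y i` has a point of `T`
within `977/5000000`, then `i` is charge-free at tolerance `1/100`. [folklore] -/
theorem isChargeFree_of_ratioGermMatched
    (hT1 : ∀ z ∈ T, ∀ w ∈ T, z ≠ w → (8793 / 10000 : ℝ) ≤ dist z w)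
    (hT2 : ∀ z₀ ∈ T, ∀ z ∈ T, z ≠ z₀ → dist z z₀ < 1231 / 1000 → dist z z₀ ≤ 10747 / 10000)
    (hT3 : ∀ z₀ ∈ T, {z ∈ T | z ≠ z₀ ∧ dist z z₀ < 1231 / 1000}.ncard = 12)
    (hT4 : ∀ z₀ ∈ T, ∀ z ∈ T, z ≠ z₀ → dist z z₀ < 1231 / 1000 →
      {w ∈ T | w ≠ z₀ ∧ w ≠ z ∧ dist w z₀ < 1231 / 1000 ∧ dist w z < 1231 / 1000}.ncard = 4)
    (hR : ∀ z₀ ∈ T, dist z₀ (y i) ≤ 4885 / 2000 → ∀ z ∈ T, ∀ z' ∈ T, z ≠ z₀ → z' ≠ z₀ →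
      dist z z₀ < 1231 / 1000 → dist z' z₀ < 1231 / 1000 → dist z z₀ ≤ 2007 / 2000 * dist z' z₀)
    (hsep : ∀ j k, j ≠ k → dist (y j) (y i) ≤ 2931 / 1000 → (977 / 2000 : ℝ) ≤ dist (y j) (y k))
    (hM2 : ∀ z ∈ T, dist z (y i) ≤ 2931 / 1000 → ∃ j, dist (y j) z ≤ 977 / 8000)
    (hB : ∀ j, dist (y j) (y i) ≤ 4885 / 2000 → ∃ z ∈ T, dist (y j) z < 977 / 5000000) :
    IsChargeFree (1 / 100 : ℝ) y i := by
  haveI : Nonempty X := ⟨y i⟩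
  haveI : Nonempty ι := ⟨i⟩
  choose! Z hZ using hB
  choose! J hJ using hM2
  obtain ⟨hz₀, hiz₀⟩ := hZ i (by rw [dist_self]; norm_num)
  have h12 := hT3 (Z i) hz₀
  obtain ⟨z₁, hz₁, hne₁, hd₁⟩ := Set.nonempty_of_ncard_ne_zero
    (s := {z ∈ T | z ≠ Z i ∧ dist z (Z i) < 1231 / 1000}) (by rw [h12]; norm_num)
  obtain ⟨-, hhi₁, -, hdist₁, hiJ₁⟩ := rgerm_near_site hT1 hT2 hZ hJ hz₀ hiz₀ hz₁ hne₁ hd₁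
  have hnt : ∀ j : ι, ∃ k, k ≠ j := fun j => by
    by_cases h : j = i
    · subst h
      exact ⟨J z₁, hiJ₁.symm⟩
    · exact ⟨i, Ne.symm h⟩
  have hnni : nearestDist y i ≤ 1076 / 1000 :=
    (nearestDist_le_dist y hiJ₁.symm).trans (by linarith)
  have hN := rgerm_neighborSet_root hT1 hT2 hR hsep hZ hJ hz₀ hiz₀ hnt hnni
  have hinj := rgerm_injOn hT1 hJ
  have hsub : {z ∈ T | z ≠ Z i ∧ dist z (Z i) < 1231 / 1000} ⊆
      {z ∈ T | dist z (y i) ≤ 2931 / 1000} := by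
    rintro z ⟨hz, -, hd⟩
    have := dist_triangle_right z (y i) (Z i)
    exact ⟨hz, by linarith⟩
  refine ⟨?_, fun j hj => ?_⟩
  · rw [hN, (hinj.mono hsub).ncard_image, h12]
  · rw [hN] at hj
    obtain ⟨z, ⟨hz, hne, hd⟩, rfl⟩ := hj
    rw [ringNumber_def, hN, rgerm_inter_neighborSet hT1 hT2 hR hsep hZ hJ hz₀ hiz₀ hnt hz hne hd,
      (hinj.mono ?_).ncard_image, hT4 (Z i) hz₀ z hz hne hd]
    rintro w ⟨hw, hwne, -, hwd, -⟩
    exact hsub ⟨hw, hwne, hwd⟩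

end RatioGermMatched

/-- **The abstract charge-freeness engine in ratio form** (stub T2 of the line
`elastic-basin-split`; registered signature verbatim): a site `y i` two-way matched — coarsely
(`977/8000`) from the reference side within `2.931`, finely (`977/5000000`) from the
configuration side within `2.4425` — to a `0.8793`-separated point set `T` with twelve near
points (`< 1.231`, all `≤ 1.0747`) around every centre, four common near points around every
near pair, and per-centre near-length ratios `≤ 2007/2000` around the centres within `2.4425`
of `y i`, the sites within `2.931` of `y i` being `0.4885`-separated, is charge-free at
tolerance `1/100`. [folklore] -/
theorem stub_ratioGermEngine :
    ∀ (N : ℕ) (y : Fin N → EuclideanSpace ℝ (Fin 3)) (i : Fin N) (T : Set (EuclideanSpace ℝ (Fin 3))), (∀ z ∈ T, ∀ w ∈ T, z ≠ w → (8793 / 10000 : ℝ) ≤ dist z w) → (∀ z₀ ∈ T, ∀ z ∈ T, z ≠ z₀ → dist z z₀ < 1231 / 1000 → dist z z₀ ≤ 10747 / 10000) → (∀ z₀ ∈ T, {z ∈ T | z ≠ z₀ ∧ dist z z₀ < 1231 / 1000}.ncard = 12) → (∀ z₀ ∈ T, ∀ z ∈ T, z ≠ z₀ → dist z z₀ < 1231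 / 1000 → {w ∈ T | w ≠ z₀ ∧ w ≠ z ∧ dist w z₀ < 1231 / 1000 ∧ dist w z < 1231 / 1000}.ncard = 4) → (∀ z₀ ∈ T, dist z₀ (y i) ≤ 4885 / 2000 → ∀ z ∈ T, ∀ z' ∈ T, z ≠ z₀ → z' ≠ z₀ → dist z z₀ < 1231 / 1000 → dist z' z₀ < 1231 / 1000 → dist z z₀ ≤ 2007 / 2000 * dist z' z₀) → (∀ j k : Fin N, j ≠ k → dist (y j) (y i) ≤ 2931 / 1000 → 977 / 2000 ≤ dist (y j) (y k)) → (∀ z ∈ T, dist z (y i) ≤ 2931 / 1000 → ∃ j : Fin N, dist (y j) z ≤ 977 / 8000) → (∀ j : Fin N, dist (y j) (y i) ≤ 4885 / 2000 → ∃ z ∈ T, dist (y j) z < 977 / 5000000) → Literature.Geometry.DiscreteGeometry.IsChargeFree (1 / 100 : ℝ) y i := by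
  intro N y i T hT1 hT2 hT3 hT4 hR hsep hM2 hB
  exact isChargeFree_of_ratioGermMatched hT1 hT2 hT3 hT4 hR hsep hM2 hB

end Summit.AtomisticToContinuum.Crystallization.Theorems.PricedLinkCensusTruncatedCensusGap

end
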